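import Mathlib
import Summits.Ventures.HodgeRepro.Tier4.Line1.RelClosed
import Summits.Ventures.HodgeRepro.Tier4.Line1.ConvTest

/-!
# Tier4/Line1/GeneratedSubspace — the composition law `R(f')(R(f)ψ) = R(f' ⋆ f)ψ`, and the invariant subspace
`span {R(f) n}` GENERATED by a subspace `N` (the `H`-module generated by `N` in the block language)

Blind re-derivation cell `pub-hodge-repro`, Tier 4 (README §9–§10), seat t4-L1-p2 (gen 4), LINE L1.  Target tree path
`lean/Summits/Ventures/HodgeRepro/Tier4/Line1/GeneratedSubspace.lean`.  Imports t4-L1-p4's `RelClosed` (`inner_eq_L2`,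
`toLp_add'`, `R_invariant`, `continuous_R_of_invariant`; through it `RtfSpectralStep`'s `memLp_two_DG`) and this seat's
`ConvTest` (`conv_isTest`).  0 print.  Companion of `BlockSimple` ((C1) simplicity of a finite block), which consumes
`generated`, `isInvariantSubspace_generated`, `e_generated_mem`, `inner_add_left_pi`, `toLpOn`.

WHAT THIS IS.
* `R_R_eq_R_conv` — the composition law `R(f') (R(f) ψ) = R(f' ⋆ f) ψ` for test functions `f', f` and a continuous
  `ψ` (`conv f' f (g) = ∫ f'(h) f(h⁻¹ g) dh`): the substitution `g ↦ h⁻¹ g` in the inner integral by the left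
  invariance of the Haar measure, then Fubini on `μ.prod μ` (the integrand is continuous with compact support in
  `tsupport f' × tsupport f' · tsupport f`); `R_rightTranslate` — `(R(f) ψ)(x g) = R(f(g⁻¹ ·)) ψ (x)`.
* `R_add'`, `R_smul'`, `R_zero'` — linearity of `R(f)` on continuous functions (after t4-L1-p1's unlanded draft);
  `inner_add_left_pi`; `toLpOn W hc : W →ₗ[ℂ] L²(DG)` — the class map on a submodule of continuous functions, with
  `toLpOn_coeFn`.
* `generated N := span {R(f) n | f test, n ∈ N}` — for `N` a submodule of functions inside an invariant `V`, this is an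
  `IsInvariantSubspace` contained in `V` (`isInvariantSubspace_generated`, `generated_subset`): right translation by
  `R_rightTranslate`, `conv` by the composition law and `conv_isTest`; `e_generated_mem` — a map `e` linear on `V` with
  `e (R f n) ∈ N` for every generator maps `generated N` into `N`.

NOT claimed: anything about (C1)/(C2) themselves (see `BlockSimple`), the dictionary `tf`, (S1a), `P_T4`.  Nothing here
says anything about the status of the Hodge conjecture for CM abelian varieties, which is NOT proved (HC_CM is NOT
proved by anyone in this repository).
-/


set_option autoImplicit false

noncomputable section

namespace Summit.Ventures.HodgeRepro.Tier4.Line1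

open MeasureTheory Topology
open scoped ComplexConjugate

namespace RTF

namespace Setting

variable {G : Type} [Group G] [TopologicalSpace G] [IsTopologicalGroup G] [MeasurableSpace G] [BorelSpace G]
  (S : Setting G)

section Composition

/-- the integrand of the composition law is integrable on `μ.prod μ` (continuous with compact support in
`tsupport f' × (tsupport f' · tsupport f)`). -/
theorem integrable_prod_conv [SecondCountableTopology G] [T2Space G] {f' f ψ : G → ℂ} (hf' : IsTest f')
    (hf : IsTest f) (hψ : Continuous ψ) (x : G) :
    Integrable (Function.uncurry fun (h g : G) => f' h * (f (h⁻¹ * g) * ψ (x * g))) (S.μ.prod S.μ) := by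
  haveI := S.haar
  apply Continuous.integrable_of_hasCompactSupport
  · apply Continuous.mul
    · exact hf'.cont.comp continuous_fst
    · apply Continuous.mul
      · exact hf.cont.comp (continuous_fst.inv.mul continuous_snd)
      · exact hψ.comp (continuous_const.mul continuous_snd)
  · apply HasCompactSupport.intro (hf'.compact.prod (hf'.compact.mul hf.compact))
    intro p hp
    show f' p.1 * (f (p.1⁻¹ * p.2) * ψ (x * p.2)) = 0
    by_cases h1 : p.1 ∈ tsupport f'
    · have h2 : p.1⁻¹ * p.2 ∉ tsupport f := by
        intro h
        apply hp
        refine ⟨h1, ?_⟩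
        have : p.2 = p.1 * (p.1⁻¹ * p.2) := by group
        rw [this]
        exact Set.mul_mem_mul h1 h
      rw [image_eq_zero_of_notMem_tsupport h2, zero_mul, mul_zero]
    · rw [image_eq_zero_of_notMem_tsupport h1, zero_mul]

/-- **the composition law** `R(f') (R(f) ψ) = R(f' ⋆ f) ψ` for test functions `f', f` and a continuous `ψ`
(`conv f' f (g) = ∫ f'(h) f(h⁻¹ g) dh`): the substitution `g ↦ h⁻¹ g` in the inner integral (left invariance of the
Haar measure) and Fubini. -/
theorem R_R_eq_R_conv [SecondCountableTopology G] [T2Space G] [MeasurableMul G] [SFinite S.μ]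
    {f' f ψ : G → ℂ} (hf' : IsTest f') (hf : IsTest f) (hψ : Continuous ψ) :
    S.R f' (S.R f ψ) = S.R (S.conv f' f) ψ := by
  haveI := S.haar
  funext x
  have hint := S.integrable_prod_conv hf' hf hψ x
  -- the inner `G`-integral for a fixed `h`, after the substitution `g ↦ h⁻¹ g`
  have hinner : ∀ h : G, S.R f ψ (x * h) = ∫ g, f (h⁻¹ * g) * ψ (x * g) ∂S.μ := by
    intro h
    unfold R
    have hsub := integral_mul_left_eq_self (μ := S.μ) (fun g => f (h⁻¹ * g) * ψ (x * g)) h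
    rw [← hsub]
    congr 1
    funext g
    simp only [inv_mul_cancel_left, mul_assoc]
  calc S.R f' (S.R f ψ) x
      = ∫ h, ∫ g, f' h * (f (h⁻¹ * g) * ψ (x * g)) ∂S.μ ∂S.μ := by
        unfold R
        congr 1
        funext h
        rw [← R, hinner h, integral_const_mul]
    _ = ∫ g, ∫ h, f' h * (f (h⁻¹ * g) * ψ (x * g)) ∂S.μ ∂S.μ := integral_integral_swap hint
    _ = ∫ g, S.conv f' f g * ψ (x * g) ∂S.μ := by
        congr 1
        funext g
        unfold conv
        rw [← integral_mul_const]
        congr 1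
        funext h
        ring
    _ = S.R (S.conv f' f) ψ x := rfl

omit [IsTopologicalGroup G] [BorelSpace G] in
/-- **right translation of `R(f) ψ`**: `(R(f) ψ)(x g) = R(f(g⁻¹ ·)) ψ (x)` (the substitution `h ↦ g⁻¹ h`, left
invariance of the Haar measure). -/
theorem R_rightTranslate [MeasurableMul G] (f ψ : G → ℂ) (g : G) :
    (fun x => S.R f ψ (x * g)) = S.R (fun y => f (g⁻¹ * y)) ψ := by
  haveI := S.haar
  funext x
  unfold R
  have hsub := integral_mul_left_eq_self (μ := S.μ) (fun y => f (g⁻¹ * y) * ψ (x * y)) g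
  rw [← hsub]
  congr 1
  funext h
  simp only [inv_mul_cancel_left, mul_assoc]

omit [MeasurableSpace G] [BorelSpace G] in
/-- the left translate of a test function is a test function. -/
theorem IsTest.leftTranslate {f : G → ℂ} (hf : IsTest f) (g : G) : IsTest fun y => f (g⁻¹ * y) :=
  ⟨hf.cont.comp (continuous_const.mul continuous_id), hf.compact.comp_homeomorph (Homeomorph.mulLeft g⁻¹)⟩

/-- linearity of `R(f)` on continuous functions: `R(f)(ψ + φ) = R(f)ψ + R(f)φ` (after t4-L1-p1's draft). -/
theorem R_add' {f : G → ℂ} (hf : IsTest f) {ψ φ : G → ℂ} (hψ : Continuous ψ) (hφ : Continuous φ) :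
    S.R f (ψ + φ) = S.R f ψ + S.R f φ := by
  haveI : S.μ.IsHaarMeasure := S.haar
  funext x
  unfold R
  rw [Pi.add_apply, ← integral_add]
  · congr 1
    funext g
    rw [Pi.add_apply]
    ring
  · exact (hf.cont.mul (hψ.comp (continuous_const.mul continuous_id))).integrable_of_hasCompactSupport
      hf.compact.mul_right
  · exact (hf.cont.mul (hφ.comp (continuous_const.mul continuous_id))).integrable_of_hasCompactSupport
      hf.compact.mul_right

omit [IsTopologicalGroup G] [BorelSpace G] in
/-- linearity of `R(f)`: `R(f)(c ψ) = c R(f)ψ`. -/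
theorem R_smul' (f : G → ℂ) (ψ : G → ℂ) (c : ℂ) : S.R f (c • ψ) = c • S.R f ψ := by
  funext x
  unfold R
  rw [Pi.smul_apply, smul_eq_mul, ← integral_const_mul]
  congr 1
  funext g
  rw [Pi.smul_apply, smul_eq_mul]
  ring

omit [IsTopologicalGroup G] [BorelSpace G] in
/-- `R(f) 0 = 0`. -/
theorem R_zero' (f : G → ℂ) : S.R f (0 : G → ℂ) = 0 := by
  funext x
  simp [R]

omit [IsTopologicalGroup G] [BorelSpace G] in
/-- the zero function lies in every non-empty invariant subspace. -/
theorem IsInvariantSubspace.zero_mem_of_nonempty {V : Set (G → ℂ)} (hV : S.IsInvariantSubspace V)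
    (hne : V.Nonempty) : (0 : G → ℂ) ∈ V := by
  obtain ⟨ψ, hψ⟩ := hne
  have h := hV.smul ψ hψ 0
  have h0 : (fun x => (0 : ℂ) * ψ x) = (0 : G → ℂ) := funext fun x => zero_mul _
  rw [h0] at h
  exact h

omit [IsTopologicalGroup G] in
/-- `S.inner` is additive in the first argument (continuous functions). -/
theorem inner_add_left_pi {ψ φ w : G → ℂ} (hψ : Continuous ψ) (hφ : Continuous φ) (hw : Continuous w) :
    S.inner (ψ + φ) w = S.inner ψ w + S.inner φ w := by
  rw [S.inner_eq_L2 (hψ.add hφ) hw, S.inner_eq_L2 hψ hw, S.inner_eq_L2 hφ hw, ← inner_add_right,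
    ← MemLp.toLp_add]

/-- the `L²(DG)` class of a continuous function, as a linear map on a submodule of continuous functions (after
t4-L1-p1's draft). -/
def toLpOn (W : Submodule ℂ (G → ℂ)) (hc : ∀ ψ ∈ W, Continuous ψ) : W →ₗ[ℂ] Lp ℂ 2 (S.μ.restrict S.DG) where
  toFun ψ := (S.memLp_two_DG (hc ψ ψ.2)).toLp ψ
  map_add' ψ φ := by
    rw [← MemLp.toLp_add]
    rfl
  map_smul' c ψ := by
    rw [RingHom.id_apply, ← MemLp.toLp_const_smul]
    rfl

omit [IsTopologicalGroup G] in
/-- the class of `ψ ∈ W` is a.e. `ψ` on `DG`. -/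
theorem toLpOn_coeFn (W : Submodule ℂ (G → ℂ)) (hc : ∀ ψ ∈ W, Continuous ψ) (ψ : W) :
    ⇑(S.toLpOn W hc ψ) =ᵐ[S.μ.restrict S.DG] (ψ : G → ℂ) :=
  MemLp.coeFn_toLp (S.memLp_two_DG (hc ψ ψ.2))

end Composition

section Generated

variable {V : Set (G → ℂ)}

/-- the generators `R(f) n` of the invariant subspace generated by `N`. -/
def genSet (N : Submodule ℂ (G → ℂ)) : Set (G → ℂ) := {u | ∃ f, IsTest f ∧ ∃ n ∈ N, u = S.R f n}

/-- **the invariant subspace generated by `N`**: the span of the `R(f) n`, `f` a test function, `n ∈ N`. -/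
def generated (N : Submodule ℂ (G → ℂ)) : Submodule ℂ (G → ℂ) := Submodule.span ℂ (S.genSet N)

omit [IsTopologicalGroup G] [BorelSpace G] in
/-- `R(f) n` is a generator. -/
theorem mem_genSet {N : Submodule ℂ (G → ℂ)} {f : G → ℂ} (hf : IsTest f) {n : G → ℂ} (hn : n ∈ N) :
    S.R f n ∈ S.genSet N := ⟨f, hf, n, hn, rfl⟩

omit [IsTopologicalGroup G] [BorelSpace G] in
/-- `R(f) n` lies in the generated subspace. -/
theorem R_mem_generated {N : Submodule ℂ (G → ℂ)} {f : G → ℂ} (hf : IsTest f) {n : G → ℂ} (hn : n ∈ N) :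
    S.R f n ∈ S.generated N := Submodule.subset_span (S.mem_genSet hf hn)

omit [IsTopologicalGroup G] [BorelSpace G] in
/-- the generated subspace lies in every invariant `V` containing `N`. -/
theorem generated_subset (hV : S.IsInvariantSubspace V) {N : Submodule ℂ (G → ℂ)} (hNV : (N : Set (G → ℂ)) ⊆ V) :
    (S.generated N : Set (G → ℂ)) ⊆ V := by
  intro u hu
  refine Submodule.span_induction (p := fun u _ => u ∈ V) ?_ ?_ ?_ ?_ hu
  · rintro u ⟨f, hf, n, hn, rfl⟩
    exact hV.conv n (hNV hn) f hf
  · exact IsInvariantSubspace.zero_mem_of_nonempty S hV ⟨0, hNV N.zero_mem⟩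
  · intro x y _ _ hx hy
    exact hV.add x hx y hy
  · intro c x _ hx
    exact hV.smul x hx c

/-- **the generated subspace is an invariant subspace** (right translation by `R_rightTranslate`, `conv` by the
composition law and `conv_isTest`). -/
theorem isInvariantSubspace_generated [SecondCountableTopology G] [T2Space G] [MeasurableMul G] [SFinite S.μ]
    (hV : S.IsInvariantSubspace V) {N : Submodule ℂ (G → ℂ)} (hNV : (N : Set (G → ℂ)) ⊆ V) :
    S.IsInvariantSubspace (S.generated N) := by
  have hsub := S.generated_subset hV hNV
  refine ⟨fun φ hφ => hV.inv φ (hsub hφ), fun φ hφ => hV.cont φ (hsub hφ), ?_, ?_, ?_, ?_⟩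
  · -- right translation
    intro φ hφ g
    refine Submodule.span_induction (p := fun φ _ => (fun x => φ (x * g)) ∈ S.generated N) ?_ ?_ ?_ ?_ hφ
    · rintro u ⟨f, hf, n, hn, rfl⟩
      rw [S.R_rightTranslate f n g]
      exact S.R_mem_generated (IsTest.leftTranslate hf g) hn
    · show (fun _ : G => (0 : ℂ)) ∈ S.generated N
      exact (S.generated N).zero_mem
    · intro x y _ _ hx hy
      exact (S.generated N).add_mem hx hy
    · intro c x _ hx
      exact (S.generated N).smul_mem c hx
  · intro φ hφ ψ hψ
    exact (S.generated N).add_mem hφ hψ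
  · intro φ hφ c
    exact (S.generated N).smul_mem c hφ
  · -- convolution
    intro φ hφ f hf
    refine Submodule.span_induction (p := fun φ _ => S.R f φ ∈ S.generated N) ?_ ?_ ?_ ?_ hφ
    · rintro u ⟨f₀, hf₀, n, hn, rfl⟩
      rw [S.R_R_eq_R_conv hf hf₀ (hV.cont n (hNV hn))]
      exact S.R_mem_generated (S.conv_isTest hf hf₀).1 hn
    · rw [S.R_zero']
      exact (S.generated N).zero_mem
    · intro x y hx hy hx' hy'
      rw [S.R_add' hf (hV.cont x (hsub hx)) (hV.cont y (hsub hy))]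
      exact (S.generated N).add_mem hx' hy'
    · intro c x _ hx'
      rw [S.R_smul']
      exact (S.generated N).smul_mem c hx'

omit [IsTopologicalGroup G] [BorelSpace G] in
/-- `e` maps the generated subspace into `N` when it maps every generator there and is linear on `V`. -/
theorem e_generated_mem (hV : S.IsInvariantSubspace V) {N : Submodule ℂ (G → ℂ)} (hNV : (N : Set (G → ℂ)) ⊆ V)
    (e : (G → ℂ) → (G → ℂ)) (he_add : ∀ ψ ∈ V, ∀ φ ∈ V, e (ψ + φ) = e ψ + e φ)
    (he_smul : ∀ ψ ∈ V, ∀ c : ℂ, e (c • ψ) = c • e ψ) (hNR : ∀ f, IsTest f → ∀ n ∈ N, e (S.R f n) ∈ N) :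
    ∀ u ∈ S.generated N, e u ∈ N := by
  have hsub := S.generated_subset hV hNV
  intro u hu
  refine Submodule.span_induction (p := fun u _ => e u ∈ N) ?_ ?_ ?_ ?_ hu
  · rintro u ⟨f, hf, n, hn, rfl⟩
    exact hNR f hf n hn
  · have h0 : e 0 = 0 := by
      have := he_smul 0 (hNV N.zero_mem) 0
      rwa [zero_smul, zero_smul] at this
    rw [h0]
    exact N.zero_mem
  · intro x y hx hy hx' hy'
    rw [he_add x (hsub hx) y (hsub hy)]
    exact N.add_mem hx' hy'
  · intro c x hx hx'
    rw [he_smul x (hsub hx) c]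
    exact N.smul_mem c hx'

end Generated

end Setting

end RTF

end Summit.Ventures.HodgeRepro.Tier4.Line1

end
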